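import Mathlib.Data.ZMod.Basic
import Mathlib.Algebra.Order.Group.Abs
import Mathlib.Data.Int.Interval
import Mathlib.Data.ZMod.Units
import Mathlib.Analysis.Normed.Field.Basic
import HarnessLib

/-!
# Route `PrimeLevelFamEdge`, crux K_B (stmt-Parity-20343), line `diagonal_kernel_split` rev 4, plan Ω,
# sub-line Ω-f/g interface (GATE G2 §(a) rows a6/a8) — **the DIVISOR SWITCH on the dual hyperbola:
# `h₁h₂ ≡ ab (mod C)` ⟺ `h₁h₂ = ab + C·s`, so the `h₂`-sum in a box is an `s`-sum, and after summing over the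
# prime levels `q` (`C = q·c`) the level runs over `q` with `h₁ ∣ ab + q·c·s` — primes in residue classes mod `h₁`**

After Ω-d (Poisson) and Ω-h (`OffDiagHeartHead.offDiagHead_eq_dual`), the heart is a block sum over prime levels `q` of
dual sums `Σ_{h ∈ ℤ²} Φ̂(h/(qc))·N_{qc}(a,b;h)`, and in the coprime stratum `N = 𝟙[h₁ unit mod qc ∧ h₁h₂ ≡ ab (mod qc)]`
(`OffDiagDual.dualCount_eq_ite_of_isUnit`). This file is the finite combinatorics that turns the congruence in `h₂`
into the divisor condition on the LEVEL (G2 a8: «for fixed `(A, c, s, d)`: `q` prime ∈ block with `q ≡ −A·(cs)⁻¹ (mod d′)`»):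

* `intCast_mul_eq_iff_exists` — `(h₁h₂ : ZMod C) = ab ⟺ ∃ s, h₁h₂ = ab + C·s` (the `s`-parametrisation);
* **`sum_hyperbola_eq_sum_switch`** — for a unit `h₁ ≠ 0` mod `C` and a box `|h₂| ≤ B`:
  `Σ_{|h₂|≤B, h₁h₂≡ab (C)} F(h₂) = Σ_{|s|≤S₀, h₁ ∣ ab+Cs, |(ab+Cs)/h₁| ≤ B} F((ab+Cs)/h₁)` whenever `C·S₀ ≥ |h₁|B + ab`
  (a bijection `h₂ ↔ s = (h₁h₂ − ab)/C`);
* **`sum_levels_switch`** — summing over a finite set of levels `q` (modulus `C = qc`), the triple sum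
  `Σ_q Σ_{h₁} Σ_{s}` is `Σ_{h₁} Σ_{s} Σ_{q : h₁ ∣ ab + qcs, …}` (exchange of finite sums): for each `(h₁, c, s)` the levels
  run over the `q` with `q·(cs) ≡ −ab (mod h₁)`;
* `dvd_iff_natCast_level_eq` — when `(cs, h₁) = 1`: `h₁ ∣ ab + q·c·s ⟺ q ≡ −ab·(cs)⁻¹ (mod |h₁|)` — an arithmetic
  progression of levels to modulus `|h₁|` (the home of Bombieri–Vinogradov / ABL Prop. 4.1 / the explicit formula).

Pure finite algebra over `ℤ` and `ZMod`; theorems only; standard axioms. Helper toward `stub_offDiagBelowSlack_io`; closes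
nothing. «The programme SEARCHES and TYPES; no claim about Landau–Siegel zeros, Theorems 1–2 of arXiv:2211.02515 or a
repaired Margin232 until a kernel theorem says so.»
-/

namespace Summit.Parity.GeneralizedHardyLittlewood.Theorems.BeyondDiagonalBeatsQuarter.OffDiag

open Finset

/-! ### The `s`-parametrisation of the dual hyperbola -/

/-- `(x : ZMod C) = y ⟺ ∃ s, x = y + C·s` for integers `x, y`. [folklore] -/
theorem intCast_eq_intCast_iff_exists {C : ℕ} (x y : ℤ) :
    ((x : ZMod C) = (y : ZMod C)) ↔ ∃ s : ℤ, x = y + (C : ℤ) * s := by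
  rw [ZMod.intCast_eq_intCast_iff_dvd_sub]
  constructor
  · rintro ⟨s, hs⟩; exact ⟨-s, by linarith⟩
  · rintro ⟨s, hs⟩; exact ⟨-s, by linarith⟩

/-- The hyperbola condition in parametrised form: `(h₁h₂ : ZMod C) = ab ⟺ ∃ s, h₁h₂ = ab + C·s`
(W-a's `OffDiagDual.dual_congruence_iff_exists_int`, restated over `ℤ`-valued frequencies). [folklore] -/
theorem intCast_mul_eq_iff_exists {C : ℕ} (a b h₁ h₂ : ℤ) :
    ((h₁ : ZMod C) * (h₂ : ZMod C) = (a : ZMod C) * (b : ZMod C)) ↔ ∃ s : ℤ, h₁ * h₂ = a * b + (C : ℤ) * s := by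
  rw [← Int.cast_mul, ← Int.cast_mul, intCast_eq_intCast_iff_exists]

/-! ### The divisor switch for one unit `h₁` -/

/-- Size of the switched variable: if `|h₂| ≤ B`, `|h₁| ≤ A` and `h₁h₂ = ab + Cs` with `C ≥ 1`, then
`|s| ≤ S₀` as soon as `A·B + |ab| ≤ C·S₀`. [folklore] -/
theorem abs_switch_le {C : ℕ} (hC : 1 ≤ C) {a b h₁ h₂ s A B S₀ : ℤ} (hA : |h₁| ≤ A) (hB : |h₂| ≤ B)
    (hs : h₁ * h₂ = a * b + (C : ℤ) * s) (hS : A * B + |a * b| ≤ (C : ℤ) * S₀) : |s| ≤ S₀ := by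
  have hC' : (0 : ℤ) < C := by exact_mod_cast hC
  have h0A : 0 ≤ A := le_trans (abs_nonneg _) hA
  have hprod : |h₁ * h₂| ≤ A * B := by
    rw [abs_mul]; exact mul_le_mul hA hB (abs_nonneg _) h0A
  have hCs : |(C : ℤ) * s| ≤ A * B + |a * b| := by
    have : (C : ℤ) * s = h₁ * h₂ - a * b := by linarith
    rw [this]
    exact (abs_sub _ _).trans (by linarith)
  rw [abs_mul, abs_of_pos hC'] at hCs
  by_contra h
  rw [not_le] at h
  have : (C : ℤ) * S₀ < (C : ℤ) * |s| := by nlinarith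
  linarith

/-- **The divisor switch for one unit frequency.** Let `C ≥ 1`, `h₁ ≠ 0`, `|h₁| ≤ A`, and `C·S₀ ≥ A·B + |ab|`. Then
`Σ_{|h₂| ≤ B, h₁h₂ ≡ ab (mod C)} F(h₂) = Σ_{|s| ≤ S₀, h₁ ∣ ab + Cs, |(ab+Cs)/h₁| ≤ B} F((ab + Cs)/h₁)`
(the bijection `h₂ ↦ s = (h₁h₂ − ab)/C`, `s ↦ h₂ = (ab + Cs)/h₁`). GATE G2 §(a) a6/a8.
[cite: KowalskiMichelVanderKam2000, Lemma 3.3 p. 9 — derivation] -/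
theorem sum_hyperbola_eq_sum_switch {C : ℕ} (hC : 1 ≤ C) {a b h₁ A B S₀ : ℤ} (hh₁ : h₁ ≠ 0) (hA : |h₁| ≤ A)
    {M : Type*} [AddCommMonoid M]
    (hS : A * B + |a * b| ≤ (C : ℤ) * S₀) (F : ℤ → M) :
    ∑ h₂ ∈ (Icc (-B) B).filter (fun h₂ : ℤ ↦ (h₁ : ZMod C) * (h₂ : ZMod C) = (a : ZMod C) * (b : ZMod C)), F h₂ =
      ∑ s ∈ (Icc (-S₀) S₀).filter (fun s : ℤ ↦ h₁ ∣ a * b + (C : ℤ) * s ∧ |(a * b + (C : ℤ) * s) / h₁| ≤ B),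
        F ((a * b + (C : ℤ) * s) / h₁) := by
  have hC' : (C : ℤ) ≠ 0 := by exact_mod_cast (show C ≠ 0 by omega)
  refine Finset.sum_bij' (fun h₂ _ ↦ (h₁ * h₂ - a * b) / (C : ℤ)) (fun s _ ↦ (a * b + (C : ℤ) * s) / h₁)
    ?_ ?_ ?_ ?_ ?_
  · -- `i` lands in the target
    intro h₂ hh₂
    rw [Finset.mem_filter, Finset.mem_Icc] at hh₂ ⊢
    obtain ⟨hbox, hcong⟩ := hh₂
    obtain ⟨s, hs⟩ := (intCast_mul_eq_iff_exists a b h₁ h₂).mp hcong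
    have hsdef : (h₁ * h₂ - a * b) / (C : ℤ) = s := by
      rw [hs, show a * b + (C : ℤ) * s - a * b = (C : ℤ) * s by ring, Int.mul_ediv_cancel_left _ hC']
    rw [hsdef]
    have habs : |s| ≤ S₀ := abs_switch_le hC hA (abs_le.mpr hbox) hs hS
    have hdiv : (a * b + (C : ℤ) * s) / h₁ = h₂ := by
      rw [← hs, mul_comm, Int.mul_ediv_cancel _ hh₁]
    refine ⟨abs_le.mp habs, ⟨h₂, by rw [← hs, mul_comm]⟩, ?_⟩
    rw [hdiv]; exact abs_le.mpr hbox
  · -- `j` lands in the source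
    intro s hs
    rw [Finset.mem_filter, Finset.mem_Icc] at hs ⊢
    obtain ⟨-, ⟨t, ht⟩, hbox⟩ := hs
    have hdiv : (a * b + (C : ℤ) * s) / h₁ = t := by rw [ht, Int.mul_ediv_cancel_left _ hh₁]
    rw [hdiv] at hbox ⊢
    refine ⟨abs_le.mp hbox, ?_⟩
    rw [intCast_mul_eq_iff_exists]
    exact ⟨s, by rw [← ht]⟩
  · -- `j ∘ i = id`
    intro h₂ hh₂
    rw [Finset.mem_filter] at hh₂
    obtain ⟨s, hs⟩ := (intCast_mul_eq_iff_exists a b h₁ h₂).mp hh₂.2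
    rw [hs, show a * b + (C : ℤ) * s - a * b = (C : ℤ) * s by ring, Int.mul_ediv_cancel_left _ hC', ← hs,
      mul_comm, Int.mul_ediv_cancel _ hh₁]
  · -- `i ∘ j = id`
    intro s hs
    rw [Finset.mem_filter] at hs
    obtain ⟨-, ⟨t, ht⟩, -⟩ := hs
    rw [ht, Int.mul_ediv_cancel_left _ hh₁, ← ht, show a * b + (C : ℤ) * s - a * b = (C : ℤ) * s by ring,
      Int.mul_ediv_cancel_left _ hC']
  · -- values agree
    intro h₂ hh₂
    rw [Finset.mem_filter] at hh₂
    obtain ⟨s, hs⟩ := (intCast_mul_eq_iff_exists a b h₁ h₂).mp hh₂.2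
    rw [hs, show a * b + (C : ℤ) * s - a * b = (C : ℤ) * s by ring, Int.mul_ediv_cancel_left _ hC', ← hs,
      mul_comm, Int.mul_ediv_cancel _ hh₁]

/-! ### Summing over the levels: the level runs over a divisor class -/

/-- **Exchange of the level sum with the switched dual sum** (finite sums). For a finite set of levels `Q`, a
weight `G q h₁ s` and the switched condition `P q h₁ s` (decidable):
`Σ_{q∈Q} Σ_{h₁∈H} Σ_{s∈S, P q h₁ s} G = Σ_{h₁∈H} Σ_{s∈S} Σ_{q∈Q, P q h₁ s} G` — for each `(h₁, s)` the levels run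
over the `q ∈ Q` satisfying the divisor condition (G2 a8: «for fixed `(A,c,s,d)`: `q` prime ∈ block with …»). [folklore] -/
theorem sum_levels_switch {ι : Type*} (Q : Finset ℕ) (H S : Finset ι) (P : ℕ → ι → ι → Prop)
    [∀ q h s, Decidable (P q h s)] {M : Type*} [AddCommMonoid M] (G : ℕ → ι → ι → M) :
    ∑ q ∈ Q, ∑ h₁ ∈ H, ∑ s ∈ S.filter (fun s ↦ P q h₁ s), G q h₁ s =
      ∑ h₁ ∈ H, ∑ s ∈ S, ∑ q ∈ Q.filter (fun q ↦ P q h₁ s), G q h₁ s := by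
  rw [Finset.sum_comm]
  refine Finset.sum_congr rfl fun h₁ _ ↦ ?_
  simp_rw [Finset.sum_filter]
  rw [Finset.sum_comm]

/-- **The divisor condition on the level is an arithmetic progression.** For integers `n` (the modulus-to-be,
`= h₁`), `m` (`= c·s`) with `(m, n) = 1`, and `A` (`= ab`): `n ∣ A + q·m ⟺ (q : ZMod n.natAbs) = −A·m⁻¹`.
[folklore] -/
theorem dvd_iff_natCast_level_eq {n m A : ℤ} (hmn : IsCoprime m n) (q : ℕ) :
    n ∣ A + (q : ℤ) * m ↔
      ((q : ℤ) : ZMod n.natAbs) = -(A : ZMod n.natAbs) * ((m : ZMod n.natAbs))⁻¹ := by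
  -- `m` is a unit modulo `|n|`
  have hcop : IsCoprime ((n.natAbs : ℕ) : ℤ) m := by
    rcases Int.natAbs_eq n with h | h
    · rw [← h]; exact hmn.symm
    · have h' : ((n.natAbs : ℕ) : ℤ) = -n := by linarith
      rw [h']; exact hmn.symm.neg_left
  have hunit : IsUnit ((m : ZMod n.natAbs)) := (ZMod.coe_int_isUnit_iff_isCoprime m n.natAbs).mpr hcop
  -- divisibility as vanishing in `ZMod |n|`
  have hdvd : n ∣ A + (q : ℤ) * m ↔ ((A + (q : ℤ) * m : ℤ) : ZMod n.natAbs) = 0 := by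
    rw [ZMod.intCast_zmod_eq_zero_iff_dvd, Int.natAbs_dvd]
  rw [hdvd, Int.cast_add, Int.cast_mul]
  constructor
  · intro h
    have h1 : ((q : ℤ) : ZMod n.natAbs) * (m : ZMod n.natAbs) = -(A : ZMod n.natAbs) :=
      eq_neg_of_add_eq_zero_right h
    calc ((q : ℤ) : ZMod n.natAbs)
        = ((q : ℤ) : ZMod n.natAbs) * ((m : ZMod n.natAbs) * ((m : ZMod n.natAbs))⁻¹) := by
          rw [ZMod.mul_inv_of_unit _ hunit, mul_one]
      _ = -(A : ZMod n.natAbs) * ((m : ZMod n.natAbs))⁻¹ := by rw [← mul_assoc, h1]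
  · intro h
    rw [h, mul_assoc, ZMod.inv_mul_of_unit _ hunit, mul_one, add_neg_cancel]

end Summit.Parity.GeneralizedHardyLittlewood.Theorems.BeyondDiagonalBeatsQuarter.OffDiag
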